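import Literature.AlgebraicGeometry.AbelianSchemes.AbelianVarietyCechInversionMaps
import Literature.AlgebraicGeometry.AbelianSchemes.AbelianVarietyCechCupSurjectiveAnyChar
import Literature.AlgebraicGeometry.Morphisms.CechModuleH2OrderedTransport
import HarnessLib

/-!
# `[−1]^* = +1` on `Ȟ²(𝒪)` of an abelian variety whenever `Ȟ¹ ∪ Ȟ¹ = Ȟ²`, ordered and RAW module Čech currencies
# (Mumford AV §13 Cor. 2; Oort 1971, proof of (2.2.1); The Stacks Project 01FP ∕ 01XD)

Layer `Literature/AlgebraicGeometry/AbelianSchemes`; namespaces `Literature.AlgebraicGeometry.AbelianSchemes.AbelianVarietyCech` (§1–§2) and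
`Literature.AlgebraicGeometry.AbelianSchemes.AbelianSchemeOver` (§3).  PROOF file (theorems only; no definition, no instance, no notation,
no named fact, no `sorry`).  Sequel of ★ `AbelianVarietyCechInversionMaps` (`ι^* a = − ref a` on `Ȟ¹`, multiplicativity); twin of ★
`AbelianVarietyCechMulTwo` §«degree two» ∕ ★ `AbelianVarietyCechH2MulTwoRaw` with `[2] ↦ ι = [−1]` and `(2·2) ↦ (−1)·(−1) = 1`:

* §1 `invI_degree_two_of_surjective` — **`ι^* x = ref x` on `Ȟ²(U, 𝒪_A)`** read on the inversion cover, GIVEN that the cup product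
  `Ȟ¹(U) ⊗ Ȟ¹(U) → Ȟ²(U)` is onto (hypothesis `hsurj`: ★ `cup_one_one_surjective` in characteristic `0`; from the `H¹`-count in any
  characteristic, (G4) `AbelianVarietyCechCupSurjectiveAnyChar`): `ι^*(a ∪ b) = (−ref a) ∪ (−ref b) = ref (a ∪ b)`;
* §2 the heads with only the inversion cover as binder (`homologyMap_inv_degree_one`, `homologyMap_inv_degree_two_of_surjective`,
  `homologyMap_inv_degree_two` for `[CharZero k]`);
* §3 **`AbelianSchemeOver.cechMH2_mk_refine_comap_inv_of_surjective`** — RAW module Čech currency, arbitrary refinement (★ N4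
  `CechMH2.mk_refineC2_comapC2_eq_smul_of_ordered` at `g := ι`, `c₀ := 1`): for an affine open cover `𝓤` of `B` (any index type), a raw
  `2`-cocycle `z` of `𝒪_B` and affine opens `W_s ⊆ U_{τ s} ∩ ι⁻¹U_{τ′ s}`: **`[ρ_{τ′}(ι^* z)] = [ρ_τ z]` in `Ȟ²(𝓦, 𝒪_B)`**, given cup-surjectivity
  on the finite affine subcovers of `𝓤`; `…_inv` the `[CharZero k]` instance; `…_inv_of_finrank_cechH1` the ANY-characteristic instance
  from the `H¹`-count through ★ (G4) `AbelianVarietyCechCupSurjectiveAnyChar`.  This is the cohomology half (O4) of the (U-ab) assembler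
  «`[−1]^*` acts trivially on `Ȟ²(X_κ, 𝒪)`, hence by `−1` on `Ȟ²(X_κ, 𝒯) = Ȟ²(𝒪) ⊗ 𝔱`» of [Oort1971] pp. 279–280.

Cell `hodgecm-mathlib` (D-0151), FLOOR 0 ∕ P6 (U)-road organ (O4); generic, count-neutral — HC_CM is proved only modulo the 7 printed
citations until rung 0 closes, and nothing here refers to it.

## References
* D. Mumford, *Abelian Varieties* (1970), §13 Cor. 2 (p. 129). [MumfordAV1970]
* F. Oort, *Finite group schemes, local moduli for abelian varieties, and lifting problems*, Compositio Math. 23 (1971), proof of Thm. (2.2.1),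
  pp. 279–280. [Oort1971]
* The Stacks Project, Tags 01FP, 01XD. [StacksProject]
-/

noncomputable section

open CategoryTheory CategoryTheory.Limits CategoryTheory.MonoidalCategory AlgebraicGeometry TopologicalSpace Opposite
open HomologicalComplex TensorProduct Finset
open Literature.Algebra.Homology Literature.Algebra.Homology.OrderedCech Literature.AlgebraicGeometry.Modules
open Literature.AlgebraicGeometry.Morphisms

set_option backward.isDefEq.respectTransparency false

namespace Literature.AlgebraicGeometry.AbelianSchemes

namespace AbelianVarietyCech

universe u

/-! ## §1 `ι^* = +1` on `Ȟ²(U, 𝒪_A)` from `Ȟ¹ ∪ Ȟ¹ = Ȟ²`, with the covers as binders -/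

section DegreeTwo

variable {k : Type} [Field k] (A : AbelianSchemeOver (Spec (.of k)))
  {ι : Type} [LinearOrder ι] [Fintype ι] (U : ι → A.X.left.affineOpens) (hcov : ⨆ i, (U i).1 = ⊤)
  (W₀ : ι ×ₗ ι → (X2 A).affineOpens)
  (hW₀ : ∀ i j, (W₀ (toLex (i, j))).1 = p₁ A ⁻¹ᵁ (U i).1 ⊓ p₂ A ⁻¹ᵁ (U j).1)
  (W : (ι ×ₗ ι) ×ₗ ι → (X2 A).affineOpens)
  (hW : ∀ c l, (W (toLex (c, l))).1 = (W₀ c).1 ⊓ m A ⁻¹ᵁ (U l).1)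
  (j₀ : ι) (hj₀ : e A ⁻¹ᵁ (U j₀).1 = ⊤)
  (WI : (ι ×ₗ ι) ×ₗ ι → A.X.left.affineOpens)
  (hWI : ∀ i j l, (WI (toLex (toLex (i, j), l))).1 = (U i).1 ⊓ (U j).1 ⊓ inv A ⁻¹ᵁ (U l).1)

include hcov hW₀ hW hj₀ in
/-- **`ι^* x = ref x` on `Ȟ²(U, 𝒪_A)`** (with the covers as binders), GIVEN `Ȟ¹ ⊗ Ȟ¹ ↠ Ȟ²` on `U`: write `x = Σ a ∪ b`, then
`ι^*(a ∪ b) = ι^* a ∪ ι^* b = (−ref a) ∪ (−ref b) = ref (a ∪ b)` (★ `invI_degree_one`, ★ `invI_mul`, ★ `refI_mul`).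
[cite: MumfordAV1970, §13 Cor. 2 (p. 129)] [cite: Oort1971, proof of Thm. (2.2.1), pp. 279–280] -/
theorem invI_degree_two_of_surjective (hsurj : Function.Surjective (TensorProduct.lift (cupA A U 1 1 2 rfl)))
    (x : (CA A U).homology ((2 : ℕ) : ℤ)) :
    invI A U WI hWI 2 x = refI A U WI hWI 2 x := by
  obtain ⟨t, rfl⟩ := hsurj x
  induction t using TensorProduct.induction_on with
  | zero => rw [map_zero, map_zero, map_zero]
  | tmul a b =>
    rw [TensorProduct.lift.tmul, invI_mul A U hcov WI hWI, refI_mul A U hcov WI hWI,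
      invI_degree_one A U hcov W₀ hW₀ W hW j₀ hj₀ WI hWI, invI_degree_one A U hcov W₀ hW₀ W hW j₀ hj₀ WI hWI,
      LinearMap.map_neg₂, map_neg, neg_neg]
  | add s t hs ht => rw [map_add, map_add, map_add, hs, ht]

end DegreeTwo

/-! ## §2 The heads with only the inversion cover as a binder -/

section Heads

variable {k : Type} [Field k] (A : AbelianSchemeOver (Spec (.of k)))
  {ι : Type} [LinearOrder ι] [Fintype ι] (U : ι → A.X.left.affineOpens) (hcov : ⨆ i, (U i).1 = ⊤)
  (WI : (ι ×ₗ ι) ×ₗ ι → A.X.left.affineOpens)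
  (hWI : ∀ i j l, (WI (toLex (toLex (i, j), l))).1 = (U i).1 ⊓ (U j).1 ⊓ inv A ⁻¹ᵁ (U l).1)

include hcov in
/-- **`ι^* = −1` on `Ȟ¹(U, 𝒪_A)`**: for an abelian variety `A` over a field, a finite affine open cover `U` and the inversion cover
`WI ((i,j),l) = U_i ∩ U_j ∩ ι⁻¹U_l`, the pull-back along `ι = [−1]` (index map `((i,j),l) ↦ l`) and the refinement (index map
`((i,j),l) ↦ i`) satisfy `ι^* a = − ref a` in `Ȟ¹(WI, 𝒪_A)`.  Any characteristic. [cite: MumfordAV1970, §13 Cor. 2 (p. 129)]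
[cite: Oort1971, proof of Thm. (2.2.1), pp. 279–280] -/
theorem homologyMap_inv_degree_one (a : (CA A U).homology ((1 : ℕ) : ℤ)) :
    invI A U WI hWI 1 a = -refI A U WI hWI 1 a := by
  obtain ⟨W₀, hW₀, W, hW, j₀, hj₀⟩ := exists_covers A U hcov
  exact invI_degree_one A U hcov W₀ hW₀ W hW j₀ hj₀ WI hWI a

include hcov in
/-- **`ι^* = +1` on `Ȟ²(U, 𝒪_A)` given `Ȟ¹ ∪ Ȟ¹ = Ȟ²`**: same setting, `ι^* x = ref x` in `Ȟ²(WI, 𝒪_A)`.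
[cite: MumfordAV1970, §13 Cor. 2 (p. 129)] [cite: Oort1971, proof of Thm. (2.2.1), pp. 279–280] -/
theorem homologyMap_inv_degree_two_of_surjective (hsurj : Function.Surjective (TensorProduct.lift (cupA A U 1 1 2 rfl)))
    (x : (CA A U).homology ((2 : ℕ) : ℤ)) :
    invI A U WI hWI 2 x = refI A U WI hWI 2 x := by
  obtain ⟨W₀, hW₀, W, hW, j₀, hj₀⟩ := exists_covers A U hcov
  exact invI_degree_two_of_surjective A U hcov W₀ hW₀ W hW j₀ hj₀ WI hWI hsurj x

include hcov in
/-- **`ι^* = +1` on `Ȟ²(U, 𝒪_A)` in characteristic `0`** (cup-surjectivity from ★ `cup_one_one_surjective`). [cite: MumfordAV1970, §13 Cor. 2 (p. 129)] -/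
theorem homologyMap_inv_degree_two [CharZero k] (x : (CA A U).homology ((2 : ℕ) : ℤ)) :
    invI A U WI hWI 2 x = refI A U WI hWI 2 x :=
  homologyMap_inv_degree_two_of_surjective A U hcov WI hWI (cup_one_one_surjective A U hcov) x

end Heads

end AbelianVarietyCech

/-! ## §3 RAW module Čech currency, arbitrary refinement (★ N4 at `g := ι`, `c₀ := 1`) -/

namespace AbelianSchemeOver

/-- **`[−1]^* = 1` on `Ȟ²(𝒪_B)`, raw module Čech currency, arbitrary refinement, GIVEN `Ȟ¹ ∪ Ȟ¹ = Ȟ²` on the finite affine subcovers.**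
For an abelian scheme `B` over a field `k`, an affine open cover `𝓤`, a raw `2`-cocycle `z` of `𝒪_B` on `𝓤` and affine opens
`W_s ⊆ U_{τ s} ∩ ι⁻¹U_{τ′ s}`: `[ρ_{τ′}(ι^* z)] = [ρ_τ z]` in `Ȟ²(𝓦, 𝒪_B)` — §2 (ordered classes) transported by ★ N4
`CechMH2.mk_refineC2_comapC2_eq_smul_of_ordered`; `B` is separated and compact over `k` because proper.
[cite: MumfordAV1970, §13 Cor. 2 (p. 129)] [cite: Oort1971, proof of Thm. (2.2.1), pp. 279–280] [cite: StacksProject, Tag 01XD] -/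
theorem cechMH2_mk_refine_comap_inv_of_surjective {k : Type} [Field k] (B : AbelianSchemeOver (Spec (.of k)))
    {ι : Type} (U : ι → B.X.left.affineOpens) (hU : ⨆ j, (U j).1 = ⊤)
    (hsurj : ∀ (m : ℕ) (e : Fin m → ι), (⨆ i, (U (e i)).1) = ⊤ →
      Function.Surjective (TensorProduct.lift (AbelianVarietyCech.cupA B (fun i => U (e i)) 1 1 2 rfl)))
    (z : cechMZ2 B.X.hom (SheafOfModules.unit B.X.left.ringCatSheaf) (fun j => (U j).1))
    {κ : Type} (W : κ → B.X.left.affineOpens) (τ τ' : κ → ι)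
    (hτ : ∀ s, (W s).1 ≤ (U (τ s)).1) (hτ' : ∀ s, (W s).1 ≤ (AbelianVarietyCech.inv B) ⁻¹ᵁ (U (τ' s)).1) :
    CechMH2.mk B.X.hom (SheafOfModules.unit B.X.left.ringCatSheaf) (fun s => (W s).1)
        ⟨cechMRefineC2 B.X.hom (SheafOfModules.unit B.X.left.ringCatSheaf)
            (preimageFamily (AbelianVarietyCech.inv B) (fun j => (U j).1)) (fun s => (W s).1) τ' hτ'
            (cechComapC2 B.X.hom B.X.hom (AbelianVarietyCech.inv B) (Over.w (GrpObj.inv : B.X ⟶ B.X)) (fun j => (U j).1)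
              (z : CechMC2 B.X.hom (SheafOfModules.unit B.X.left.ringCatSheaf) (fun j => (U j).1))),
          refineMC2_mem_cechMZ2 B.X.hom (SheafOfModules.unit B.X.left.ringCatSheaf)
            (preimageFamily (AbelianVarietyCech.inv B) (fun j => (U j).1)) (fun s => (W s).1) τ' hτ'
            (comapC2_mem_cechMZ2 B.X.hom B.X.hom (AbelianVarietyCech.inv B) (Over.w (GrpObj.inv : B.X ⟶ B.X))
              (fun j => (U j).1) z.2)⟩ =
      CechMH2.mk B.X.hom (SheafOfModules.unit B.X.left.ringCatSheaf) (fun s => (W s).1)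
        ⟨cechMRefineC2 B.X.hom (SheafOfModules.unit B.X.left.ringCatSheaf) (fun j => (U j).1) (fun s => (W s).1) τ hτ
            (z : CechMC2 B.X.hom (SheafOfModules.unit B.X.left.ringCatSheaf) (fun j => (U j).1)),
          refineMC2_mem_cechMZ2 B.X.hom (SheafOfModules.unit B.X.left.ringCatSheaf) (fun j => (U j).1) (fun s => (W s).1) τ hτ
            z.2⟩ := by
  haveI : IsSeparated B.X.hom := B.isProper.toIsSeparated
  haveI : CompactSpace B.X.left := by
    haveI := B.isProper
    exact QuasiCompact.compactSpace_of_compactSpace B.X.hom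
  have h := CechMH2.mk_refineC2_comapC2_eq_smul_of_ordered B.X (AbelianVarietyCech.inv B) (Over.w (GrpObj.inv : B.X ⟶ B.X))
    (1 : k) U hU
    (fun m e he WΔ hWΔ _ _ _ _ x => by
      rw [one_smul]
      exact AbelianVarietyCech.homologyMap_inv_degree_two_of_surjective B (fun i => U (e i)) he WΔ hWΔ (hsurj m e he) x)
    z W τ τ' hτ hτ'
  rw [one_smul] at h
  exact h

/-- **`[−1]^* = 1` on `Ȟ²(𝒪_B)` in characteristic `0`**, raw module Čech currency, arbitrary refinement (cup-surjectivity from ★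
`AbelianVarietyCech.cup_one_one_surjective`). [cite: MumfordAV1970, §13 Cor. 2 (p. 129)] [cite: StacksProject, Tag 01XD] -/
theorem cechMH2_mk_refine_comap_inv {k : Type} [Field k] [CharZero k] (B : AbelianSchemeOver (Spec (.of k)))
    {ι : Type} (U : ι → B.X.left.affineOpens) (hU : ⨆ j, (U j).1 = ⊤)
    (z : cechMZ2 B.X.hom (SheafOfModules.unit B.X.left.ringCatSheaf) (fun j => (U j).1))
    {κ : Type} (W : κ → B.X.left.affineOpens) (τ τ' : κ → ι)
    (hτ : ∀ s, (W s).1 ≤ (U (τ s)).1) (hτ' : ∀ s, (W s).1 ≤ (AbelianVarietyCech.inv B) ⁻¹ᵁ (U (τ' s)).1) :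
    CechMH2.mk B.X.hom (SheafOfModules.unit B.X.left.ringCatSheaf) (fun s => (W s).1)
        ⟨cechMRefineC2 B.X.hom (SheafOfModules.unit B.X.left.ringCatSheaf)
            (preimageFamily (AbelianVarietyCech.inv B) (fun j => (U j).1)) (fun s => (W s).1) τ' hτ'
            (cechComapC2 B.X.hom B.X.hom (AbelianVarietyCech.inv B) (Over.w (GrpObj.inv : B.X ⟶ B.X)) (fun j => (U j).1)
              (z : CechMC2 B.X.hom (SheafOfModules.unit B.X.left.ringCatSheaf) (fun j => (U j).1))),
          refineMC2_mem_cechMZ2 B.X.hom (SheafOfModules.unit B.X.left.ringCatSheaf)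
            (preimageFamily (AbelianVarietyCech.inv B) (fun j => (U j).1)) (fun s => (W s).1) τ' hτ'
            (comapC2_mem_cechMZ2 B.X.hom B.X.hom (AbelianVarietyCech.inv B) (Over.w (GrpObj.inv : B.X ⟶ B.X))
              (fun j => (U j).1) z.2)⟩ =
      CechMH2.mk B.X.hom (SheafOfModules.unit B.X.left.ringCatSheaf) (fun s => (W s).1)
        ⟨cechMRefineC2 B.X.hom (SheafOfModules.unit B.X.left.ringCatSheaf) (fun j => (U j).1) (fun s => (W s).1) τ hτ
            (z : CechMC2 B.X.hom (SheafOfModules.unit B.X.left.ringCatSheaf) (fun j => (U j).1)),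
          refineMC2_mem_cechMZ2 B.X.hom (SheafOfModules.unit B.X.left.ringCatSheaf) (fun j => (U j).1) (fun s => (W s).1) τ hτ
            z.2⟩ :=
  cechMH2_mk_refine_comap_inv_of_surjective B U hU
    (fun _ e he => AbelianVarietyCech.cup_one_one_surjective B (fun i => U (e i)) he)
    z W τ τ' hτ hτ'

/-- **`[−1]^* = 1` on `Ȟ²(𝒪_B)` in ANY characteristic from the `H¹`-COUNT**, raw module Čech currency, arbitrary refinement: the
cup-surjectivity on every finite affine subcover comes from ★ (G4) `AbelianVarietyCech.cup_one_one_surjective_of_dim_le_finrank_cechH1`, fed by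
a count `dim B ≤ dim_k Ȟ¹(V, 𝒪_B) + 1` on all finite affine covers `V` (the conclusion shape of ★
`CechH1CountOfPoincareDataHead.finite_finrank_cechH1_eq_dim_of_letter_field` for Poincaré∕DUALS-letter data).
[cite: MumfordAV1970, §13 Cor. 2 (p. 129)] [cite: Oort1971, proof of Thm. (2.2.1), pp. 279–280] [cite: StacksProject, Tag 01XD] -/
theorem cechMH2_mk_refine_comap_inv_of_finrank_cechH1 {k : Type} [Field k] (B : AbelianSchemeOver (Spec (.of k)))
    {ι : Type} (U : ι → B.X.left.affineOpens) (hU : ⨆ j, (U j).1 = ⊤)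
    (hH1 : ∀ {J : Type} [Finite J] (V : J → B.X.left.Opens), (∀ j, IsAffineOpen (V j)) → iSup V = ⊤ →
      B.toAffine.toAbelianVariety.dim ≤ Module.finrank k (CechH1 B.X.hom V) + 1)
    (z : cechMZ2 B.X.hom (SheafOfModules.unit B.X.left.ringCatSheaf) (fun j => (U j).1))
    {κ : Type} (W : κ → B.X.left.affineOpens) (τ τ' : κ → ι)
    (hτ : ∀ s, (W s).1 ≤ (U (τ s)).1) (hτ' : ∀ s, (W s).1 ≤ (AbelianVarietyCech.inv B) ⁻¹ᵁ (U (τ' s)).1) :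
    CechMH2.mk B.X.hom (SheafOfModules.unit B.X.left.ringCatSheaf) (fun s => (W s).1)
        ⟨cechMRefineC2 B.X.hom (SheafOfModules.unit B.X.left.ringCatSheaf)
            (preimageFamily (AbelianVarietyCech.inv B) (fun j => (U j).1)) (fun s => (W s).1) τ' hτ'
            (cechComapC2 B.X.hom B.X.hom (AbelianVarietyCech.inv B) (Over.w (GrpObj.inv : B.X ⟶ B.X)) (fun j => (U j).1)
              (z : CechMC2 B.X.hom (SheafOfModules.unit B.X.left.ringCatSheaf) (fun j => (U j).1))),
          refineMC2_mem_cechMZ2 B.X.hom (SheafOfModules.unit B.X.left.ringCatSheaf)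
            (preimageFamily (AbelianVarietyCech.inv B) (fun j => (U j).1)) (fun s => (W s).1) τ' hτ'
            (comapC2_mem_cechMZ2 B.X.hom B.X.hom (AbelianVarietyCech.inv B) (Over.w (GrpObj.inv : B.X ⟶ B.X))
              (fun j => (U j).1) z.2)⟩ =
      CechMH2.mk B.X.hom (SheafOfModules.unit B.X.left.ringCatSheaf) (fun s => (W s).1)
        ⟨cechMRefineC2 B.X.hom (SheafOfModules.unit B.X.left.ringCatSheaf) (fun j => (U j).1) (fun s => (W s).1) τ hτ
            (z : CechMC2 B.X.hom (SheafOfModules.unit B.X.left.ringCatSheaf) (fun j => (U j).1)),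
          refineMC2_mem_cechMZ2 B.X.hom (SheafOfModules.unit B.X.left.ringCatSheaf) (fun j => (U j).1) (fun s => (W s).1) τ hτ
            z.2⟩ :=
  cechMH2_mk_refine_comap_inv_of_surjective B U hU
    (fun _ e he => AbelianVarietyCech.cup_one_one_surjective_of_dim_le_finrank_cechH1 B (fun i => U (e i)) he
      (hH1 (fun i => (U (e i)).1) (fun i => (U (e i)).2) he))
    z W τ τ' hτ hτ'

end AbelianSchemeOver

end Literature.AlgebraicGeometry.AbelianSchemes

end
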